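import Summits.QuantumFields.YangMills.Theorems.AllWindowsColdBoxBoxHighLineQuadFormCum3Chart

/-!
# The triangle contraction for colour-diagonal rank-one forms (U5 prep, lift L2): `Σ A₀B_TM·GGG = K(0,T)·Σ_κΣ_{ee'} (wG)_e M_{(e,κ),(e',κ)} (Gu)_{e'}`

Width seat `ym-line-sfw-p2-w3` (g41), cell ym-idea-1; helper-grade algebra for the `ConnectedThreePoint` bound of U5-BLOCKERS §2 L2 (companion of
✓`…QuadFormCum3Chart`: `gaussCum3_quadVal` gives `κ₃ = β⁻³·Σ_{aa'bb'cc'} A_{aa'}B_{bb'}M_{cc'}G_{a'b}G_{b'c}G_{c'a}`).  On an index type `E × Fin 3`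
(edges × colours) a matrix `X` is COLOUR-DIAGONAL with edge kernel `x` when `X (e,κ) (e',κ') = [κ = κ']·x e e'`; the Gaussian parts of the plaquette
observables are the colour-diagonal RANK-ONE forms `A (e,κ)(e',κ') = [κ=κ']·u e·u e'` (`linCurvSq H p = quadVal A` with `u = landauCoeff H p`, next file)
and the propagator `G = (hodgeQ H ⊗ₖ 1)⁻¹` is colour-diagonal with kernel `g = (hodgeQ H)⁻¹`.  This file proves, for a general finite `E`:

* `colourDiag_mul_apply` / `mul_colourDiag_apply` — `(X * Y)_{(e,κ) j} = Σ_{e'} x e e'·Y_{(e',κ) j}`, `(Y * X)_{i (e,κ)} = Σ_{e'} Y_{i (e',κ)}·x e' e`;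
  `sum_rankOne_mul` — `Σ_{aa'} A_{aa'} N_{a'a} = Σ_κ Σ_{ee'} u e·u e'·N_{(e',κ)(e,κ)}`;
* ★★ `triangle_contract` — **the contraction identity**
  `Σ_{aa'bb'cc'} A_{aa'}B_{bb'}M_{cc'}·G_{a'b}G_{b'c}G_{c'a} = (u ⬝ᵥ g w) · Σ_κ Σ_{e,e'} (w ᵥ* g) e · M_{(e,κ),(e',κ)} · (g *ᵥ u) e'`
  (one DIPOLE line `u·g·w = K(p₀,p_T)` between the two plaquettes, two GRADIENT lines `g u`, `w g` into the vertex `M`; `M` arbitrary);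
* ★ `abs_triangle_le` — hence `|Σ…| ≤ B_K · Σ_κ Σ_{e,e'} B_w(e)·B_M(e,e',κ)·B_u(e')` under pointwise bounds `|u⬝gw| ≤ B_K`, `|(w ᵥ* g) e| ≤ B_w e`, `|(g *ᵥ u) e'| ≤ B_u e'`,
  `|M_{(e,κ),(e',κ)}| ≤ B_M e e' κ`.
The cold-box instantiation (✓U1c dipole decay × ✓H4b.1′ gradient decay × a `(1+d)⁻⁴` vertex kernel, summed by ✓`EdgeSums.edgeTwoCentreSums`) is the next file.

Pure finite-sum algebra (Mathlib only beyond the import); no definitions; standard axioms.  HONEST LABEL: a tool for the RECORDED lift L2 of the NEXT rung U5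
(⟨stmt-QuantumFields-24336⟩, UNSTAFFED); ⟨24004⟩ ⟨24336⟩ remain OPEN; route AllWindowsColdBox is DRAFT; no crux, rung or summit is proved; **the Yang–Mills
mass gap is NOT proved by this file; no summit is proved by a line.**
-/

set_option autoImplicit false

noncomputable section

open Matrix Finset

namespace Summit.QuantumFields.YangMills.Theorems.AllWindowsColdBoxBoxHighLine

namespace ColourDiag

variable {E : Type*} [Fintype E]

/-! ## Colour-diagonal matrices on `E × Fin 3` -/

/-- Left multiplication by a colour-diagonal matrix. -/
theorem colourDiag_mul_apply {x : E → E → ℝ} {X : Matrix (E × Fin 3) (E × Fin 3) ℝ}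
    (hX : ∀ i j, X i j = if i.2 = j.2 then x i.1 j.1 else 0) (Y : Matrix (E × Fin 3) (E × Fin 3) ℝ) (i j : E × Fin 3) :
    (X * Y) i j = ∑ e, x i.1 e * Y (e, i.2) j := by
  rw [Matrix.mul_apply, Fintype.sum_prod_type]
  refine Finset.sum_congr rfl fun e _ => ?_
  simp only [hX, ite_mul, zero_mul]
  rw [Finset.sum_ite_eq]
  simp

/-- Right multiplication by a colour-diagonal matrix. -/
theorem mul_colourDiag_apply {x : E → E → ℝ} {X : Matrix (E × Fin 3) (E × Fin 3) ℝ}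
    (hX : ∀ i j, X i j = if i.2 = j.2 then x i.1 j.1 else 0) (Y : Matrix (E × Fin 3) (E × Fin 3) ℝ) (i j : E × Fin 3) :
    (Y * X) i j = ∑ e, Y i (e, j.2) * x e j.1 := by
  rw [Matrix.mul_apply, Fintype.sum_prod_type]
  refine Finset.sum_congr rfl fun e _ => ?_
  simp only [hX, mul_ite, mul_zero]
  rw [Finset.sum_ite_eq']
  simp

/-- Pairing a colour-diagonal rank-one form with any matrix: `Σ_{aa'} A_{aa'} N_{a'a} = Σ_κ Σ_{ee'} u e·u e'·N_{(e',κ)(e,κ)}`. -/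
theorem sum_rankOne_mul (u : E → ℝ) {A : Matrix (E × Fin 3) (E × Fin 3) ℝ}
    (hA : ∀ i j, A i j = if i.2 = j.2 then u i.1 * u j.1 else 0) (N : Matrix (E × Fin 3) (E × Fin 3) ℝ) :
    (∑ a, ∑ a', A a a' * N a' a) = ∑ κ : Fin 3, ∑ e, ∑ e', u e * u e' * N (e', κ) (e, κ) := by
  rw [Fintype.sum_prod_type, Finset.sum_comm]
  refine Finset.sum_congr rfl fun κ _ => Finset.sum_congr rfl fun e _ => ?_
  rw [Fintype.sum_prod_type]
  refine Finset.sum_congr rfl fun e' _ => ?_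
  simp only [hA, ite_mul, zero_mul]
  rw [Finset.sum_ite_eq]
  simp

/-! ## The triangle contraction -/

/-- The six-fold triangle sum as the pairing of `A` with the cyclic product `G·B·G·M·G`. -/
theorem sum6_eq_sum_mul_prod (A B G M : Matrix (E × Fin 3) (E × Fin 3) ℝ) :
    (∑ a, ∑ a', ∑ b, ∑ b', ∑ c, ∑ c', A a a' * B b b' * M c c' * (G a' b * G b' c * G c' a)) =
      ∑ a, ∑ a', A a a' * (G * (B * (G * (M * G)))) a' a := by
  refine Finset.sum_congr rfl fun a _ => Finset.sum_congr rfl fun a' _ => ?_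
  simp only [Matrix.mul_apply, Finset.mul_sum]
  exact Finset.sum_congr rfl fun b _ => Finset.sum_congr rfl fun b' _ => Finset.sum_congr rfl fun c _ =>
    Finset.sum_congr rfl fun c' _ => by ring

/-- The inner vertex sum, factored: `Σ_{b'} w b'·(Σ_c g b' c·(Σ_{c'} M_{(c,κ)(c',κ)}·g c' e)) = Σ_c Σ_{c'} (w ᵥ* g) c · M_{(c,κ)(c',κ)} · g c' e`. -/
theorem vertex_factor (w : E → ℝ) (g : Matrix E E ℝ) (M : Matrix (E × Fin 3) (E × Fin 3) ℝ) (κ : Fin 3) (e : E) :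
    (∑ b', w b' * ∑ c, g b' c * ∑ c', M (c, κ) (c', κ) * g c' e) =
      ∑ c, ∑ c', (w ᵥ* g) c * M (c, κ) (c', κ) * g c' e := by
  have h1 : (∑ b', w b' * ∑ c, g b' c * ∑ c', M (c, κ) (c', κ) * g c' e) =
      ∑ b', ∑ c, ∑ c', w b' * g b' c * (M (c, κ) (c', κ) * g c' e) := by
    refine Finset.sum_congr rfl fun b' _ => ?_
    rw [Finset.mul_sum]
    refine Finset.sum_congr rfl fun c _ => ?_
    rw [Finset.mul_sum, Finset.mul_sum]
    exact Finset.sum_congr rfl fun c' _ => by ring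
  rw [h1, Finset.sum_comm]
  refine Finset.sum_congr rfl fun c _ => ?_
  rw [Finset.sum_comm]
  refine Finset.sum_congr rfl fun c' _ => ?_
  rw [← Finset.sum_mul, Matrix.vecMul, dotProduct]
  ring

/-- ★★ **The triangle contraction identity.**  For colour-diagonal rank-one `A` (kernel `u`), `B` (kernel `w`), colour-diagonal `G` (kernel `g`)
and any `M`:
`Σ_{aa'bb'cc'} A_{aa'}B_{bb'}M_{cc'}·G_{a'b}G_{b'c}G_{c'a} = (u ⬝ᵥ g w)·Σ_κ Σ_{e e'} (w ᵥ* g) e·M_{(e,κ)(e',κ)}·(g u) e'`. -/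
theorem triangle_contract (u w : E → ℝ) (g : Matrix E E ℝ) {A B G : Matrix (E × Fin 3) (E × Fin 3) ℝ} (M : Matrix (E × Fin 3) (E × Fin 3) ℝ)
    (hA : ∀ i j, A i j = if i.2 = j.2 then u i.1 * u j.1 else 0) (hB : ∀ i j, B i j = if i.2 = j.2 then w i.1 * w j.1 else 0)
    (hG : ∀ i j, G i j = if i.2 = j.2 then g i.1 j.1 else 0) :
    (∑ a, ∑ a', ∑ b, ∑ b', ∑ c, ∑ c', A a a' * B b b' * M c c' * (G a' b * G b' c * G c' a)) =
      (u ⬝ᵥ (g *ᵥ w)) * ∑ κ : Fin 3, ∑ e, ∑ e', (w ᵥ* g) e * M (e, κ) (e', κ) * (g *ᵥ u) e' := by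
  rw [sum6_eq_sum_mul_prod, sum_rankOne_mul u hA]
  have hB' : ∀ i j, B i j = if i.2 = j.2 then (fun e e' => w e * w e') i.1 j.1 else 0 := hB
  simp only [colourDiag_mul_apply hG, colourDiag_mul_apply (x := fun e e' => w e * w e') hB', mul_colourDiag_apply hG]
  -- for each colour: `Σ_e Σ_{e'} u e·u e'·Σ_b g e' b·(w b·V e) = (Σ_{e'} u e'·(g w) e')·(Σ_e u e·V e)`
  rw [Finset.mul_sum]
  refine Finset.sum_congr rfl fun κ _ => ?_
  have hinner : ∀ e e' : E, (∑ b, g e' b * ∑ b', w b * w b' * ∑ c, g b' c * ∑ c', M (c, κ) (c', κ) * g c' e) =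
      (g *ᵥ w) e' * ∑ c, ∑ c', (w ᵥ* g) c * M (c, κ) (c', κ) * g c' e := by
    intro e e'
    have h2 : ∀ b : E, (∑ b', w b * w b' * ∑ c, g b' c * ∑ c', M (c, κ) (c', κ) * g c' e) =
        w b * ∑ b', w b' * ∑ c, g b' c * ∑ c', M (c, κ) (c', κ) * g c' e := fun b => by
      rw [Finset.mul_sum]; exact Finset.sum_congr rfl fun b' _ => by ring
    simp_rw [h2, vertex_factor w g M κ e]
    rw [Matrix.mulVec, dotProduct, Finset.sum_mul]
    exact Finset.sum_congr rfl fun b _ => by ring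
  simp_rw [hinner]
  -- now `Σ_e Σ_{e'} u e * u e' * ((g w) e' * V e) = (u ⬝ g w) * Σ_c Σ_{c'} (w g) c * M * (g u) c'`
  have h3 : (∑ e, ∑ e', u e * u e' * ((g *ᵥ w) e' * ∑ c, ∑ c', (w ᵥ* g) c * M (c, κ) (c', κ) * g c' e)) =
      (∑ e', u e' * (g *ᵥ w) e') * ∑ e, u e * ∑ c, ∑ c', (w ᵥ* g) c * M (c, κ) (c', κ) * g c' e := by
    rw [Finset.sum_mul_sum, Finset.sum_comm]
    exact Finset.sum_congr rfl fun e _ => Finset.sum_congr rfl fun e' _ => by ring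
  rw [h3]
  congr 1
  -- `Σ_e u e · Σ_c Σ_{c'} X c c' · g c' e = Σ_c Σ_{c'} X c c' · (g u) c'`
  have h4 : (∑ e, u e * ∑ c, ∑ c', (w ᵥ* g) c * M (c, κ) (c', κ) * g c' e) =
      ∑ e, ∑ c, ∑ c', (w ᵥ* g) c * M (c, κ) (c', κ) * (g c' e * u e) := by
    refine Finset.sum_congr rfl fun e _ => ?_
    rw [Finset.mul_sum]
    refine Finset.sum_congr rfl fun c _ => ?_
    rw [Finset.mul_sum]
    exact Finset.sum_congr rfl fun c' _ => by ring
  rw [h4, Finset.sum_comm]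
  refine Finset.sum_congr rfl fun c _ => ?_
  rw [Finset.sum_comm]
  refine Finset.sum_congr rfl fun c' _ => ?_
  rw [← Finset.mul_sum, Matrix.mulVec, dotProduct]

/-- ★ **Termwise bound on the triangle.**  Under pointwise bounds on the dipole, the two gradient lines and the vertex kernel:
`|Σ A B M GGG| ≤ B_K · Σ_κ Σ_{e e'} B_w e · B_M e e' κ · B_u e'`. -/
theorem abs_triangle_le (u w : E → ℝ) (g : Matrix E E ℝ) {A B G : Matrix (E × Fin 3) (E × Fin 3) ℝ} (M : Matrix (E × Fin 3) (E × Fin 3) ℝ)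
    (hA : ∀ i j, A i j = if i.2 = j.2 then u i.1 * u j.1 else 0) (hB : ∀ i j, B i j = if i.2 = j.2 then w i.1 * w j.1 else 0)
    (hG : ∀ i j, G i j = if i.2 = j.2 then g i.1 j.1 else 0)
    {BK : ℝ} {Bu Bw : E → ℝ} {BM : E → E → Fin 3 → ℝ} (hK : |u ⬝ᵥ (g *ᵥ w)| ≤ BK)
    (hw : ∀ e, |(w ᵥ* g) e| ≤ Bw e) (hu : ∀ e, |(g *ᵥ u) e| ≤ Bu e) (hM : ∀ e e' κ, |M (e, κ) (e', κ)| ≤ BM e e' κ) :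
    |∑ a, ∑ a', ∑ b, ∑ b', ∑ c, ∑ c', A a a' * B b b' * M c c' * (G a' b * G b' c * G c' a)| ≤
      BK * ∑ κ : Fin 3, ∑ e, ∑ e', Bw e * BM e e' κ * Bu e' := by
  rw [triangle_contract u w g M hA hB hG, abs_mul]
  have hBK : 0 ≤ BK := (abs_nonneg _).trans hK
  have hterm : ∀ κ e e', |(w ᵥ* g) e * M (e, κ) (e', κ) * (g *ᵥ u) e'| ≤ Bw e * BM e e' κ * Bu e' := by
    intro κ e e'
    rw [abs_mul, abs_mul]
    have h1 := hw e; have h2 := hM e e' κ; have h3 := hu e'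
    have hBw : 0 ≤ Bw e := (abs_nonneg _).trans h1
    have hBM : 0 ≤ BM e e' κ := (abs_nonneg _).trans h2
    exact mul_le_mul (mul_le_mul h1 h2 (abs_nonneg _) hBw) h3 (abs_nonneg _) (mul_nonneg hBw hBM)
  have hS : |∑ κ : Fin 3, ∑ e, ∑ e', (w ᵥ* g) e * M (e, κ) (e', κ) * (g *ᵥ u) e'| ≤
      ∑ κ : Fin 3, ∑ e, ∑ e', Bw e * BM e e' κ * Bu e' := by
    refine (Finset.abs_sum_le_sum_abs _ _).trans (Finset.sum_le_sum fun κ _ => ?_)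
    refine (Finset.abs_sum_le_sum_abs _ _).trans (Finset.sum_le_sum fun e _ => ?_)
    exact (Finset.abs_sum_le_sum_abs _ _).trans (Finset.sum_le_sum fun e' _ => hterm κ e e')
  have hS0 : 0 ≤ ∑ κ : Fin 3, ∑ e, ∑ e', Bw e * BM e e' κ * Bu e' :=
    (abs_nonneg _).trans hS
  exact mul_le_mul hK hS (abs_nonneg _) hBK

end ColourDiag

end Summit.QuantumFields.YangMills.Theorems.AllWindowsColdBoxBoxHighLine

end
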